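import Mathlib.Analysis.InnerProductSpace.PiL2
import Mathlib.Analysis.Complex.Basic
import Mathlib.Analysis.Calculus.ContDiff.Basic
import Mathlib.Analysis.Calculus.ContDiff.WithLp
import HarnessLib

-- provenance: harness21/H21/H21/Prelude/Sobolev/Complexify.lean @ 882a183 (interim HEAD d8f2665); M5 mechanical rewrite
/-!
# Complexification of real Euclidean space (Sobolev trunk, glue C0)

This file provides the coordinatewise embedding
`EuclideanSpace ℝ ι →ₗᵢ[ℝ] EuclideanSpace ℂ ι`, `v ↦ (fun i ↦ (v i : ℂ))`, as a real linear
isometry, together with the small API needed downstream (torus Sobolev norms are defined via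
complex Fourier coefficients `UnitAddTorus.mFourierCoeff`, so real vector fields
`u : 𝕋ᵈ → EuclideanSpace ℝ d` are fed in as `complexify ∘ u`; see the outline
`H21/Outlines/Sobolev.md`, §C0 and decision D2').

## Mathlib

* For *scalars* nothing new is needed: Mathlib has `Complex.ofRealLI : ℝ →ₗᵢ[ℝ] ℂ` and
  `Complex.ofRealCLM : ℝ →L[ℝ] ℂ` (`Mathlib/Analysis/Complex/Basic.lean`); real scalar fields
  `θ` are complexified as `(↑) ∘ θ`.
* Mathlib (at the pinned commit) has no complexification of `EuclideanSpace`/`PiLp`; the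
  definition below is built with `WithLp.toLp 2` and the isometry property is proved from
  `EuclideanSpace.norm_eq`.
* `contDiff_piLp` / `contDiff_euclidean` (`Mathlib/Analysis/Calculus/ContDiff/WithLp.lean`)
  reduce smoothness of `EuclideanSpace`-valued maps to coordinates.

## Design

The declarations live in `namespace Literature.EuclideanSpace`, so that the main definition is
`Literature.Analysis.FunctionSpaces.EuclideanSpace.complexify`; this is a *deliberate dot-notation-style extension* of Mathlib's
`EuclideanSpace` inside the `Literature` namespace (per the outline, §2), not a declaration in a Mathlib
namespace.

## References

* Standard; e.g. L. Grafakos, *Classical Fourier Analysis* (3rd ed., 2014), §3.1 (Fourier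
  coefficients of vector-valued functions on the torus are taken componentwise over `ℂ`).
-/

noncomputable section

namespace Literature.Analysis.FunctionSpaces

namespace EuclideanSpace

variable {ι : Type*} [Fintype ι]

/-- The coordinatewise complexification `ℝ^ι → ℂ^ι`, `v ↦ (i ↦ (v i : ℂ))`, as a real linear
isometry `EuclideanSpace ℝ ι →ₗᵢ[ℝ] EuclideanSpace ℂ ι`. This is the vector analogue of Mathlib's
`Complex.ofRealLI`; it is used to feed real vector fields into complex Fourier analysis
(outline `Sobolev.md`, §C0/D2'; Grafakos, *Classical Fourier Analysis*, §3.1).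
The name `Literature.Analysis.FunctionSpaces.EuclideanSpace.complexify` is a deliberate dot-style extension of `EuclideanSpace`. [folklore] -/
def complexify : EuclideanSpace ℝ ι →ₗᵢ[ℝ] EuclideanSpace ℂ ι where
  toFun v := WithLp.toLp 2 fun i => (v i : ℂ)
  map_add' v w := by
    ext i
    simp
  map_smul' c v := by
    ext i
    simp
  norm_map' v := by
    simp [EuclideanSpace.norm_eq]

/-- Coordinates of the complexification: `(complexify v) i = (v i : ℂ)`
(outline `Sobolev.md`, §C0). [folklore] -/
@[simp]
theorem complexify_apply (v : EuclideanSpace ℝ ι) (i : ι) : complexify v i = (v i : ℂ) := rfl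

/-- The complexification is norm-preserving: `‖complexify v‖ = ‖v‖`
(outline `Sobolev.md`, §C0; immediate from `LinearIsometry.norm_map`, which is already a simp lemma,
so this restatement carries no `@[simp]` attribute). [folklore] -/
theorem norm_complexify (v : EuclideanSpace ℝ ι) : ‖complexify v‖ = ‖v‖ :=
  complexify.norm_map v

/-- The complexification `ℝ^ι → ℂ^ι` is injective (outline `Sobolev.md`, §C0). [folklore] -/
theorem complexify_injective : Function.Injective (complexify : EuclideanSpace ℝ ι → _) :=
  fun v w h => by
    ext i
    exact Complex.ofReal_injective (congrArg (fun z : EuclideanSpace ℂ ι => z i) h)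

/-- The complexification intertwines the real and complex inner products:
`⟪complexify v, complexify w⟫_ℂ = (⟪v, w⟫_ℝ : ℂ)` (outline `Sobolev.md`, §C0). [folklore] -/
theorem inner_complexify (v w : EuclideanSpace ℝ ι) :
    inner ℂ (complexify v) (complexify w) = ((inner ℝ v w : ℝ) : ℂ) := by
  simp [PiLp.inner_apply, mul_comm]

/-- The complexification `ℝ^ι → ℂ^ι` is continuous (outline `Sobolev.md`, §C0). [folklore] -/
@[fun_prop]
theorem continuous_complexify : Continuous (complexify : EuclideanSpace ℝ ι → _) :=
  complexify.continuous

/-- A map `f : E → ℝ^ι` is `C^n` iff its complexification `complexify ∘ f : E → ℂ^ι` is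
(both are equivalent to smoothness of all coordinates, `contDiff_euclidean` and
`Complex.ofRealCLM`; outline `Sobolev.md`, §C0). [folklore] -/
theorem contDiff_complexify_comp_iff {E : Type*} [NormedAddCommGroup E] [NormedSpace ℝ E]
    {n : WithTop ℕ∞} {f : E → EuclideanSpace ℝ ι} :
    ContDiff ℝ n (complexify ∘ f) ↔ ContDiff ℝ n f := by
  rw [contDiff_piLp (𝕜 := ℝ) 2 (f := complexify ∘ f), contDiff_piLp (𝕜 := ℝ) 2 (f := f)]
  refine forall_congr' fun i => ?_
  change ContDiff ℝ n (fun x => ((f x i : ℝ) : ℂ)) ↔ _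
  constructor
  · intro h
    convert Complex.reCLM.contDiff.comp h using 1
    ext x
    simp
  · intro h
    exact Complex.ofRealCLM.contDiff.comp h

end EuclideanSpace

end Literature.Analysis.FunctionSpaces
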